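import Mathlib
import Literature.AlgebraicGeometry.Resolution.PointBlowupFlagInvariant
import Literature.AlgebraicGeometry.Resolution.PointBlowupHeightVectorDrops
import Literature.AlgebraicGeometry.Resolution.PointBlowupFlagShiftBound
import Literature.AlgebraicGeometry.Resolution.PointBlowupFlagMaximalShift
import Summits.ResolutionOfSingularities.ResolutionOfSingularities.Theorems.WeightedInvariantLocalWeightedDropInsepNewtonMeasures
import Summits.ResolutionOfSingularities.ResolutionOfSingularities.Theorems.WeightedInvariantLocalWeightedDropInsepNewtonVMove
import Summits.ResolutionOfSingularities.ResolutionOfSingularities.Theorems.WeightedInvariantLocalWeightedDropInsepNewtonHMove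
import Summits.ResolutionOfSingularities.ResolutionOfSingularities.Theorems.WeightedInvariantLocalWeightedDropInsepNewtonShear
import Summits.ResolutionOfSingularities.ResolutionOfSingularities.Theorems.WeightedInvariantLocalWeightedDropInsepNewtonTChart

/-!
# `WeightedInvariant.LocalWeightedDrop`, line `hasse-ridge-face-selection`: Hauser–Wagner's LIFT of a subordinate shear at the
# successor point to a shear at the centre («φ′(F*) = (φ(F))*», [HW14] §6.2) in the lift's chart coordinates — unit M6a dictionary

Crux item stmt-ResolutionOfSingularities-8899 `LocalWeightedDrop` (route `ResolutionOfSingularities/WeightedInvariant`),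
serving the door `WeightedConstruction` stmt-ResolutionOfSingularities-0571.  [OURS · L1 W4.3, chain w43, stub worker 3
(gen 3): §1/§6 «dictionary lemma» of L/res-L1-w43-stub-3/M6-DESIGN.md (S2iM calibration track, CHAIN D12); the mathematics is the
one-line computation of Hauser–Wagner, L'Enseignement Math. 60 (2014) §6.2 p. 206 («φ′ : (y,z) ↦ (y + A(z), z) … φ : (y,z) ↦
(y + z·A(z), z) … φ′(F*(y,z)) = F((y + A(z))z, z) = (φ(F))*»), written for the lift's chart `π_H(c₁) : x₁ ↦ c₁X₀, x₀ ↦ X₀X₁` (any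
`c₁ ≠ 0`); NOT a statement of any manuscript.]

Before the move: free `= 0`, rigid `= 1`, shears `θ_ψ : x₀ ↦ x₀ + ψ(x₁)`.  After the move: rigid `= 0` (`X₀`, exceptional), free `= 1`,
shears `θ′_{φ′} : X₁ ↦ X₁ + φ′(X₀)`.
* `subst_piH_subst_shear` (**the lift**): `π_H(c₁) ∘ θ_ψ = θ′_{φ′} ∘ π_H(c₁)` whenever `ψ(c₁ X₀) = X₀·φ′(X₀)`; `subst_liftShear`: every `φ′`
  has such a `ψ` (`ψ(z) = (z/c₁)·φ′(z/c₁)`); `subst_descendShear` / `constantCoeff_descendShear`: every `ψ` with `ψ(0) = 0` has such a `φ′`,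
  with `φ′(0) = 0` when `[z¹]ψ = 0` (adapted shears);
* `subst_shear'_X_sq_mul`: `θ′` fixes `X₀²`, so successors (`π^* G = X₀² A′`) are transported: `subst_piH_shear_succ`;
* `subst_pointChart_shear_succ` (**the dictionary of M6-DESIGN §1**): for the lift's chart at ANY point `c` (`c₁ ≠ 0`) and any `φ′`:
  `θ′_{φ′}^* A′` is the `π_H(c₁)`-successor of `θ_{(c₀/c₁)z + ψ}^* G` — the shears at `a′` are exactly the shears at `a` ADAPTED to `c`
  (linear part `c₀/c₁`), composed through res-lit-5/stub-6's `HauserPerlega2024.subst_shift_subst_shift`.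
-/

set_option linter.dupNamespace false -- mandated namespace of this single-conjunct summit

namespace Summit.ResolutionOfSingularities.ResolutionOfSingularities.Theorems

namespace InsepNewton

open MvPowerSeries
open Literature.AlgebraicGeometry.Resolution

variable {K : Type} [Field K]

/-! ### The shear of the NEW free letter: `θ′_{φ′} : X₁ ↦ X₁ + φ′(X₀)`, `X₀ ↦ X₀` -/

/-- `θ′_{φ′}` is substitutable (res-lit-5's `hasSubst_shift` with `x = 0`, `y = 1`). -/
theorem hasSubst_shear' {φ' : PowerSeries K} (hφ' : PowerSeries.constantCoeff φ' = 0) :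
    HasSubst (fun l : Fin 2 => if l = 1 then
      (X 1 : MvPowerSeries (Fin 2) K) + PowerSeries.subst (X 0 : MvPowerSeries (Fin 2) K) φ' else X l) :=
  HauserPerlega2024.hasSubst_shift 0 1 φ' hφ'

/-- `θ′` fixes the exceptional letter: `θ′^*(X₀² · A) = X₀² · θ′^* A`. -/
theorem subst_shear'_X_sq_mul {φ' : PowerSeries K} (hφ' : PowerSeries.constantCoeff φ' = 0) (A : MvPowerSeries (Fin 2) K) :
    subst (fun l : Fin 2 => if l = 1 then
        (X 1 : MvPowerSeries (Fin 2) K) + PowerSeries.subst (X 0 : MvPowerSeries (Fin 2) K) φ' else X l) (X 0 ^ 2 * A) =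
      X 0 ^ 2 * subst (fun l : Fin 2 => if l = 1 then
        (X 1 : MvPowerSeries (Fin 2) K) + PowerSeries.subst (X 0 : MvPowerSeries (Fin 2) K) φ' else X l) A := by
  have h := hasSubst_shear' hφ'
  rw [subst_mul h, subst_pow h, subst_X h, if_neg (show (0 : Fin 2) ≠ 1 by decide)]

/-! ### Lifted and descended shears: `ψ(c₁ X₀) = X₀ · φ′(X₀)` -/

/-- `a·z` is substitutable into a power series. -/
theorem hasSubst_C_mul_X' (a : K) : PowerSeries.HasSubst (PowerSeries.C a * PowerSeries.X : PowerSeries K) :=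
  PowerSeries.HasSubst.of_constantCoeff_zero' (by rw [map_mul, PowerSeries.constantCoeff_X, mul_zero])

/-- `c₁ X₀` is substitutable into a power series. -/
theorem hasSubst_C_mul_X_zero (c₁ : K) : PowerSeries.HasSubst (C c₁ * X 0 : MvPowerSeries (Fin 2) K) :=
  PowerSeries.HasSubst.of_constantCoeff_zero (by rw [map_mul, constantCoeff_X, mul_zero])

/-- **THE LIFT OF `φ′`**: `ψ := (X·φ′)(z/c₁)`, i.e. `ψ(z) = (z/c₁)·φ′(z/c₁)`, has `ψ(0) = 0` …
[cite: HauserWagner2014, §6.2 p. 206 (φ : (y,z) ↦ (y + z·A(z), z))] -/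
theorem constantCoeff_liftShear (c₁ : K) (φ' : PowerSeries K) :
    PowerSeries.constantCoeff (PowerSeries.subst (PowerSeries.C c₁⁻¹ * PowerSeries.X : PowerSeries K) (PowerSeries.X * φ')) = 0 :=
  PowerSeries.constantCoeff_subst_eq_zero
    (by change PowerSeries.constantCoeff (PowerSeries.C c₁⁻¹ * PowerSeries.X) = 0
        rw [map_mul, PowerSeries.constantCoeff_X, mul_zero]) _
    (by rw [map_mul, PowerSeries.constantCoeff_X, zero_mul])

/-- … and satisfies `ψ(c₁ X₀) = X₀ · φ′(X₀)`. -/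
theorem subst_liftShear {c₁ : K} (hc₁ : c₁ ≠ 0) (φ' : PowerSeries K) :
    PowerSeries.subst (C c₁ * X 0 : MvPowerSeries (Fin 2) K)
        (PowerSeries.subst (PowerSeries.C c₁⁻¹ * PowerSeries.X : PowerSeries K) (PowerSeries.X * φ')) =
      X 0 * PowerSeries.subst (X 0 : MvPowerSeries (Fin 2) K) φ' := by
  have ha := hasSubst_C_mul_X' (K := K) c₁⁻¹
  have hb := hasSubst_C_mul_X_zero (K := K) c₁
  have h0 := PowerSeries.HasSubst.X (0 : Fin 2) (S := K)
  rw [PowerSeries.subst_comp_subst_apply ha hb, PowerSeries.subst_mul hb, PowerSeries.subst_C, PowerSeries.subst_X hb]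
  have hs : (MvPowerSeries.C c₁⁻¹ * (C c₁ * X 0) : MvPowerSeries (Fin 2) K) = X 0 := by
    rw [← mul_assoc, ← map_mul, inv_mul_cancel₀ hc₁, map_one, one_mul]
  rw [hs, PowerSeries.subst_mul h0, PowerSeries.subst_X h0]

/-- **THE DESCENT OF `ψ`**: for `ψ(0) = 0`, `φ′ := c₁ · (ψ/X)(c₁ z)` satisfies `ψ(c₁ X₀) = X₀ · φ′(X₀)` … -/
theorem subst_descendShear (c₁ : K) {ψ : PowerSeries K} (hψ0 : PowerSeries.constantCoeff ψ = 0) :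
    PowerSeries.subst (C c₁ * X 0 : MvPowerSeries (Fin 2) K) ψ =
      X 0 * PowerSeries.subst (X 0 : MvPowerSeries (Fin 2) K) (PowerSeries.C c₁ *
        PowerSeries.subst (PowerSeries.C c₁ * PowerSeries.X : PowerSeries K) (PowerSeries.mk fun n => PowerSeries.coeff (n + 1) ψ)) := by
  have ha := hasSubst_C_mul_X' (K := K) c₁
  have hb := hasSubst_C_mul_X_zero (K := K) c₁
  have h0 := PowerSeries.HasSubst.X (0 : Fin 2) (S := K)
  set g := PowerSeries.mk fun n => PowerSeries.coeff (n + 1) ψ with hg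
  have hψ : ψ = PowerSeries.X * g := by
    conv_lhs => rw [PowerSeries.eq_X_mul_shift_add_const ψ, hψ0, map_zero, add_zero]
  conv_lhs => rw [hψ]
  rw [PowerSeries.subst_mul hb, PowerSeries.subst_X hb, PowerSeries.subst_mul h0, PowerSeries.subst_C,
    PowerSeries.subst_comp_subst_apply ha h0, PowerSeries.subst_mul h0, PowerSeries.subst_C, PowerSeries.subst_X h0]
  ring

/-- … and `φ′(0) = 0` as soon as `[z¹]ψ = 0` (the shear is adapted to the horizontal point). -/
theorem constantCoeff_descendShear (c₁ : K) {ψ : PowerSeries K} (hψ1 : PowerSeries.coeff 1 ψ = 0) :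
    PowerSeries.constantCoeff (PowerSeries.C c₁ *
      PowerSeries.subst (PowerSeries.C c₁ * PowerSeries.X : PowerSeries K) (PowerSeries.mk fun n => PowerSeries.coeff (n + 1) ψ)) = 0 := by
  rw [map_mul]
  have : PowerSeries.constantCoeff (PowerSeries.subst (PowerSeries.C c₁ * PowerSeries.X : PowerSeries K)
      (PowerSeries.mk fun n => PowerSeries.coeff (n + 1) ψ)) = 0 :=
    PowerSeries.constantCoeff_subst_eq_zero
      (by change PowerSeries.constantCoeff (PowerSeries.C c₁ * PowerSeries.X) = 0
          rw [map_mul, PowerSeries.constantCoeff_X, mul_zero]) _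
      (by rw [← PowerSeries.coeff_zero_eq_constantCoeff_apply, PowerSeries.coeff_mk, zero_add, hψ1])
  rw [this, mul_zero]

/-! ### The lift: `π_H(c₁) ∘ θ_ψ = θ′_{φ′} ∘ π_H(c₁)` -/

/-- **HAUSER–WAGNER'S LIFT IN THE CHART `π_H(c₁)`**: if `ψ(c₁ X₀) = X₀·φ′(X₀)` (`subst_liftShear` / `subst_descendShear`), then
shearing the old free letter by `ψ` and blowing up (`x₁ ↦ c₁X₀`, `x₀ ↦ X₀X₁`) is blowing up and shearing the new free letter by `φ′`:
`π_H(c₁)^*(θ_ψ^* G) = θ′_{φ′}^*(π_H(c₁)^* G)`. [cite: HauserWagner2014, §6.2 p. 206 («φ′(F*) = (φ(F))*»)] -/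
theorem subst_piH_subst_shear (c₁ : K) {ψ φ' : PowerSeries K} (hψ0 : PowerSeries.constantCoeff ψ = 0)
    (hφ' : PowerSeries.constantCoeff φ' = 0)
    (hrel : PowerSeries.subst (C c₁ * X 0 : MvPowerSeries (Fin 2) K) ψ = X 0 * PowerSeries.subst (X 0 : MvPowerSeries (Fin 2) K) φ')
    (G : MvPowerSeries (Fin 2) K) :
    subst (fun l : Fin 2 => if l = 1 then C c₁ * X 0 else (X 0 * X 1 : MvPowerSeries (Fin 2) K))
        (subst (fun l : Fin 2 => if l = 0 then (X 0 : MvPowerSeries (Fin 2) K) +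
          PowerSeries.subst (X 1 : MvPowerSeries (Fin 2) K) ψ else X l) G) =
      subst (fun l : Fin 2 => if l = 1 then
          (X 1 : MvPowerSeries (Fin 2) K) + PowerSeries.subst (X 0 : MvPowerSeries (Fin 2) K) φ' else X l)
        (subst (fun l : Fin 2 => if l = 1 then C c₁ * X 0 else (X 0 * X 1 : MvPowerSeries (Fin 2) K)) G) := by
  have hθ := hasSubst_shear (K := K) hψ0
  have hH := hasSubst_piH (K := K) c₁
  have hθ' := hasSubst_shear' hφ'
  rw [subst_comp_subst_apply hθ hH, subst_comp_subst_apply hH hθ']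
  congr 1
  funext l
  rcases (by fin_cases l <;> simp : l = 0 ∨ l = 1) with rfl | rfl
  · -- the old free letter: `X₀X₁ + ψ(c₁X₀) = X₀ (X₁ + φ′(X₀))`
    rw [if_pos rfl, if_neg (show (0 : Fin 2) ≠ 1 by decide), subst_add hH, subst_X hH, subst_mul hθ', subst_X hθ', subst_X hθ']
    simp only [Fin.isValue, if_true, if_false, zero_ne_one]
    have e1 : PowerSeries.subst (X 1 : MvPowerSeries (Fin 2) K) ψ =
        MvPowerSeries.subst (fun _ : Unit => (X 1 : MvPowerSeries (Fin 2) K)) ψ := PowerSeries.subst_def _ _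
    have e2 : PowerSeries.subst (C c₁ * X 0 : MvPowerSeries (Fin 2) K) ψ =
        MvPowerSeries.subst (fun _ : Unit => (C c₁ * X 0 : MvPowerSeries (Fin 2) K)) ψ := PowerSeries.subst_def _ _
    have e3 : subst (fun l : Fin 2 => if l = 1 then C c₁ * X 0 else (X 0 * X 1 : MvPowerSeries (Fin 2) K))
        (PowerSeries.subst (X 1 : MvPowerSeries (Fin 2) K) ψ) = PowerSeries.subst (C c₁ * X 0 : MvPowerSeries (Fin 2) K) ψ := by
      rw [e1, e2, subst_comp_subst_apply (PowerSeries.HasSubst.const (PowerSeries.HasSubst.X 1)) hH]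
      congr 1
      funext u
      rw [subst_X hH, if_pos rfl]
    rw [e3, hrel]
    ring
  · -- the old rigid letter: `c₁ X₀` on both sides
    rw [if_neg (show (1 : Fin 2) ≠ 0 by decide), if_pos rfl, subst_X hH, if_pos rfl, subst_mul hθ', subst_C, subst_X hθ',
      if_neg (show (0 : Fin 2) ≠ 1 by decide)]

/-- **SUCCESSORS ARE TRANSPORTED**: if `π_H(c₁)^* G = X₀² A′` and `ψ(c₁X₀) = X₀·φ′(X₀)`, then `π_H(c₁)^*(θ_ψ^* G) = X₀² · θ′_{φ′}^* A′` —
the horizontal successor of the sheared series is the sheared successor. [cite: HauserWagner2014, §6.2 p. 206] -/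
theorem subst_piH_shear_succ (c₁ : K) {ψ φ' : PowerSeries K} (hψ0 : PowerSeries.constantCoeff ψ = 0)
    (hφ' : PowerSeries.constantCoeff φ' = 0)
    (hrel : PowerSeries.subst (C c₁ * X 0 : MvPowerSeries (Fin 2) K) ψ = X 0 * PowerSeries.subst (X 0 : MvPowerSeries (Fin 2) K) φ')
    {G A' : MvPowerSeries (Fin 2) K}
    (hfac : subst (fun l : Fin 2 => if l = 1 then C c₁ * X 0 else (X 0 * X 1 : MvPowerSeries (Fin 2) K)) G = X 0 ^ 2 * A') :
    subst (fun l : Fin 2 => if l = 1 then C c₁ * X 0 else (X 0 * X 1 : MvPowerSeries (Fin 2) K))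
        (subst (fun l : Fin 2 => if l = 0 then (X 0 : MvPowerSeries (Fin 2) K) +
          PowerSeries.subst (X 1 : MvPowerSeries (Fin 2) K) ψ else X l) G) =
      X 0 ^ 2 * subst (fun l : Fin 2 => if l = 1 then
        (X 1 : MvPowerSeries (Fin 2) K) + PowerSeries.subst (X 0 : MvPowerSeries (Fin 2) K) φ' else X l) A' := by
  rw [subst_piH_subst_shear c₁ hψ0 hφ' hrel, hfac, subst_shear'_X_sq_mul hφ']

/-- **THE DICTIONARY OF M6-DESIGN §1** (any point `c` of the exceptional curve with `c₁ ≠ 0`, i.e. every point but the flag point):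
if the lift hands `π_{1,c}^* G = X₀² A′` and `ψ(c₁X₀) = X₀·φ′(X₀)`, then `θ′_{φ′}^* A′` is the `π_H(c₁)`-successor of the ADAPTED shear
`θ_{(c₀/c₁)z + ψ}^* G`: the presentations at `a′` are the (H)-images of the presentations at `a` adapted to `c` (linear part `c₀/c₁`;
`ψ = liftShear φ′` reaches every `φ′`, `subst_liftShear`). [cite: HauserWagner2014, §6.1 Rem. 10 p. 201, §6.2 p. 206] -/
theorem subst_pointChart_shear_succ (c : Fin 2 → K) (hc : c 1 ≠ 0) {ψ φ' : PowerSeries K}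
    (hψ0 : PowerSeries.constantCoeff ψ = 0) (hφ' : PowerSeries.constantCoeff φ' = 0)
    (hrel : PowerSeries.subst (C (c 1) * X 0 : MvPowerSeries (Fin 2) K) ψ = X 0 * PowerSeries.subst (X 0 : MvPowerSeries (Fin 2) K) φ')
    {G A' : MvPowerSeries (Fin 2) K}
    (hfac : subst (fun l : Fin 2 => if l = 1 then C (c 1) * X 0 else X 0 * (C (c l) + (X 1 : MvPowerSeries (Fin 2) K))) G =
      X 0 ^ 2 * A') :
    subst (fun l : Fin 2 => if l = 1 then C (c 1) * X 0 else (X 0 * X 1 : MvPowerSeries (Fin 2) K))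
        (subst (fun l : Fin 2 => if l = 0 then (X 0 : MvPowerSeries (Fin 2) K) +
          PowerSeries.subst (X 1 : MvPowerSeries (Fin 2) K) (ψ + PowerSeries.C (c 0 * (c 1)⁻¹) * PowerSeries.X) else X l) G) =
      X 0 ^ 2 * subst (fun l : Fin 2 => if l = 1 then
        (X 1 : MvPowerSeries (Fin 2) K) + PowerSeries.subst (X 0 : MvPowerSeries (Fin 2) K) φ' else X l) A' := by
  have hlin : PowerSeries.constantCoeff (PowerSeries.C (c 0 * (c 1)⁻¹) * PowerSeries.X) = 0 := constantCoeff_C_mul_X _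
  -- split the shear: first the adapted part `ψ`, then the linear part `(c₀/c₁)z`; the latter recombines with `π_H` to `π_{1,c}`
  rw [← HauserPerlega2024.subst_shift_subst_shift (1 : Fin 2) 0 one_ne_zero _ _ hψ0 hlin G, ← subst_pointChart_one_eq c hc]
  -- `π_{1,c} ∘ θ_ψ`: rewrite `π_{1,c} = π_H ∘ θ_lin`, commute the two shears, and lift `ψ` through `π_H`
  rw [subst_pointChart_one_eq c hc, HauserPerlega2024.subst_shift_subst_shift (1 : Fin 2) 0 one_ne_zero _ _ hψ0 hlin G,
    add_comm ψ, ← HauserPerlega2024.subst_shift_subst_shift (1 : Fin 2) 0 one_ne_zero _ _ hlin hψ0 G,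
    subst_piH_subst_shear (c 1) hψ0 hφ' hrel, ← subst_pointChart_one_eq c hc, hfac, subst_shear'_X_sq_mul hφ']

end InsepNewton

end Summit.ResolutionOfSingularities.ResolutionOfSingularities.Theorems
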